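import Summits.HubbardSuperconductivity.HubbardSuperconductivity.Theses.JosephsonMirror
import Summits.HubbardSuperconductivity.HubbardSuperconductivity.Theorems.JosephsonMirrorJmPairBridgeSchurBridge
import Summits.HubbardSuperconductivity.HubbardSuperconductivity.Theorems.JosephsonMirrorJmPairBridgeEveryFromSomeTorus

/-!
# Crux `JmPairBridge` (stmt-HubbardSuperconductivity-2226) — line `Sketch`, SCHUR LANDING

LEAD SKELETON, cycle 3 (line `Sketch` = ideator-2 evidence `20260816T111952Z-Sketch.lean`, which carries
TWO pure-logic landings on the crux: `PairSumRuleBridge` (built in cycles 1–2; all provable stubs landed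
p102580 p103789 p101515 p106331, its residue is the summit matrix at a point — route-circular, recorded in
`Lines/SketchDead.md`) and `jmPairBridge_of_schurEveryFromSome` (card `schur-rigid-bridge`), which this
reshaped skeleton now builds.

The crux is thesis X of route `JosephsonMirror`: the EVERY-ground-state Penrose–Onsager pair bridge
`|⟨χ, Δ_d φ⟩|² ≥ a L⁴` between the `(N_L, S^z = 0)` and `(N_L − 2, S^z = 0)` ground floors of
`hubbardTorus 2 L 1 U` (`N_L = 2⌊(1-δ)L²/2⌋`, `Δ_d = pairField dWaveFormFactor L`).

SCHUR RIGIDITY OF THE BRIDGE. Let `F` (`F₋`) be the ground floor of the sector `(N, 0)` (`(N − 2, 0)`),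
`P₋` the orthogonal projection onto `F₋`. Every unitary `X` commuting with `H`, preserving the two sectors
and twisting the pair field by a unimodular phase (`X Δ_d = ω Δ_d X`) commutes with the bridge Gram
operator `Δ_dᴴ P₋ Δ_d`; if `F` has no proper non-zero subspace invariant under a family `S` of such
unitaries (irreducibility — symmetry-ENFORCED degeneracy of the floor is allowed, only accidental
degeneracy is excluded), Schur's lemma (tree: `exists_scalar_matrixElements_of_irreducible`) makes
`‖P₋ Δ_d φ‖²` the same number `κ` for every unit `φ ∈ F`; ONE bridged unit pair `(φ₀, χ₀)` gives
`κ ≥ |⟨χ₀, Δ_d φ₀⟩|² ≥ a L⁴`, and then `χ := P₋ Δ_d φ / ‖P₋ Δ_d φ‖ ∈ F₋` bridges EVERY unit `φ ∈ F`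
with the same constant. This replaces the route's `JmCusp (ii)` (eventual SIMPLICITY of the `(N_L, 0)`
floor, generically false on open-shell sides) by irreducibility, and turns the mirror's conclusion
(`JmInterchange`: SOME bridged ground-floor pair) into X.

Stubs (self-contained signatures, tree vocabulary only, no new definitions; status 2026-08-16 cycle 3):
* `stub_schurBridge` — ABSTRACT (any finite index type): symmetric floors `F`, `F₋`, a family `S` of
  unitaries preserving both and twisting `Δ`, `F` irreducible under `S`, one bridged unit pair ⇒ every
  unit vector of `F` is bridged with the same threshold. LANDED p109405
  (`Theorems/JosephsonMirrorJmPairBridgeSchurBridge.lean`, imported).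
* `stub_everyFromSome_torus` — the torus instance: `F`, `F₋` the ground floors of `(N, 0)`, `(N − 2, 0)`
  of `hubbardTorus 2 L 1 U`, phrased with `IsGroundStateInSector`; takes the abstract lemma as a
  hypothesis. LANDED p109839 (`Theorems/JosephsonMirrorJmPairBridgeEveryFromSomeTorus.lean`, imported).
* `stub_schurGlue` — the route glue with simplicity replaced by irreducibility:
  `JmInterchange → (JmCusp (i) ∧ eventual irreducibility at the same (U, δ)) → X`, taking the torus
  instance as a hypothesis (pure logic); LANDED p110929 with the by-name corollary
  `jmPairBridge_of_interchange` p110960 (`Theorems/JosephsonMirrorJmPairBridgeSchurGlue.lean`, imported).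
* `stub_someBridgeIrreducibleWitness` — THE RESIDUE, the only remaining `sorry`: `∃ U > 0, δ ∈ (0,1/2),
  a > 0`, eventually in even `L`: an irreducible `(N_L, 0)` floor AND some bridged unit ground-floor pair.
  Its second conjunct is the conclusion of crux `JmInterchange` (stmt-2227) fed by `JmCusp (i)`
  (stmt-2228); its first conjunct is the new spectral hypothesis replacing `JmCusp (ii)`. Not claimed
  provable now (crux-sized).

Composition: `JmPairBridge_of` (residue + stubs 1–2 ⇒ crux BY NAME). The sorry-free glue form for the
route, `jmPairBridge_of_interchange_of_irreducible : JmInterchange → (gain ∧ eventual irreducible floor) →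
JmPairBridge`, and `everyFromSome_torus` (stubs 1 + 2 composed) are filed as
`Theorems/JosephsonMirrorJmPairBridgeSchurCusp.lean`; the space group as a concrete admissible symmetry
family (`spaceGroup_symmetryProps`, `exists_symmetryFamily_of_spaceGroup_irreducible`) as
`Theorems/JosephsonMirrorJmPairBridgeSpaceGroupFamily.lean`.

Sources: J.-P. Serre, *Linear Representations of Finite Groups*, §2.2 (Schur); H. Tasaki, *Physics
and Mathematics of Quantum Many-Body Systems* (2020), §2.1, App. A.2; T. Koma, H. Tasaki, J. Stat.
Phys. 76 (1994) 745, §3.4 (tower / pair matrix elements); D. J. Scalapino, Phys. Rep. 250 (1995) 329,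
§2 (`Δ_d`, `B₁g`).
-/

noncomputable section

-- the mandated namespace `Summit.<Summit>.<Problem>.Theorems` repeats `HubbardSuperconductivity`
-- (single-problem summit, D-0017), which the `dupNamespace` linter flags on every declaration
set_option linter.dupNamespace false

namespace Summit.HubbardSuperconductivity.HubbardSuperconductivity.Theorems.JosephsonMirror

open Matrix Literature.MathematicalPhysics.QuantumLattice
open Summit.HubbardSuperconductivity.HubbardSuperconductivity.Theses.JosephsonMirror
  (JmPairBridge JmInterchange)
open scoped ComplexOrder

/-! ## The remaining stub — THE RESIDUE (stubs 1–3 are LANDED and imported: `stub_schurBridge` p109405,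
`stub_everyFromSome_torus` p109839, `stub_schurGlue` + `jmPairBridge_of_interchange` p110929/p110960) -/

/-- **STUB `stub_someBridgeIrreducibleWitness`** (THE RESIDUE of the Schur landing — not claimed provable
now): some `U > 0`, `δ ∈ (0, 1/2)`, `a > 0` such that eventually in even `L` (i) the `(N_L, 0)` ground
floor of `hubbardTorus 2 L 1 U` is irreducible under some family of unitaries commuting with `H`,
preserving the sectors `(N_L, 0)`, `(N_L − 2, 0)` and twisting `Δ_d` by unimodular phases (no ACCIDENTAL
floor degeneracy; symmetry-enforced multiplets allowed), and (ii) SOME unit ground-floor pair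
`φ₀ ∈ (N_L, 0)`, `χ₀ ∈ (N_L − 2, 0)` is bridged, `a L⁴ ≤ |⟨χ₀, Δ_d φ₀⟩|²` — (ii) is the conclusion of crux
`JmInterchange` (stmt-2227) fed by `JmCusp (i)` (stmt-2228). -/
theorem stub_someBridgeIrreducibleWitness :
    ∃ U : ℝ, 0 < U ∧ ∃ δ ∈ Set.Ioo (0 : ℝ) (1 / 2), ∃ a : ℝ, 0 < a ∧ ∃ L₀ : ℕ,
      ∀ (L : ℕ) [NeZero L], Even L → L₀ ≤ L →
        (∃ S : Set (Matrix (Finset (Orb (FermionTorus 2 L))) (Finset (Orb (FermionTorus 2 L))) ℂ),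
          (∀ X ∈ S, Xᴴ * X = 1 ∧ X * hubbardTorus 2 L 1 U = hubbardTorus 2 L 1 U * X ∧
            (∀ v ∈ szSector (2 * ⌊(1 - δ) * (L : ℝ) ^ 2 / 2⌋₊) 0,
              X *ᵥ v ∈ szSector (2 * ⌊(1 - δ) * (L : ℝ) ^ 2 / 2⌋₊) 0) ∧
            (∀ v ∈ szSector (2 * ⌊(1 - δ) * (L : ℝ) ^ 2 / 2⌋₊ - 2) 0,
              X *ᵥ v ∈ szSector (2 * ⌊(1 - δ) * (L : ℝ) ^ 2 / 2⌋₊ - 2) 0) ∧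
            ∃ ω : ℂ, ‖ω‖ = 1 ∧
              X * pairField dWaveFormFactor L = ω • (pairField dWaveFormFactor L * X)) ∧
          ∀ K' : Submodule ℂ (Fock (Orb (FermionTorus 2 L))),
            K' ≤ szSector (2 * ⌊(1 - δ) * (L : ℝ) ^ 2 / 2⌋₊) 0 ⊓
                Module.End.eigenspace (Matrix.toLin' (hubbardTorus 2 L 1 U))
                  (((hubbardTorus 2 L 1 U).minEnergyOn
                    (szSector (2 * ⌊(1 - δ) * (L : ℝ) ^ 2 / 2⌋₊) 0) : ℝ) : ℂ) →
            (∀ X ∈ S, ∀ v ∈ K', X *ᵥ v ∈ K') →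
            K' = ⊥ ∨ K' = szSector (2 * ⌊(1 - δ) * (L : ℝ) ^ 2 / 2⌋₊) 0 ⊓
                Module.End.eigenspace (Matrix.toLin' (hubbardTorus 2 L 1 U))
                  (((hubbardTorus 2 L 1 U).minEnergyOn
                    (szSector (2 * ⌊(1 - δ) * (L : ℝ) ^ 2 / 2⌋₊) 0) : ℝ) : ℂ)) ∧
        (∃ φ₀ χ₀ : Fock (Orb (FermionTorus 2 L)),
          IsGroundStateInSector (hubbardTorus 2 L 1 U) (2 * ⌊(1 - δ) * (L : ℝ) ^ 2 / 2⌋₊) 0 φ₀ ∧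
          star φ₀ ⬝ᵥ φ₀ = 1 ∧
          IsGroundStateInSector (hubbardTorus 2 L 1 U) (2 * ⌊(1 - δ) * (L : ℝ) ^ 2 / 2⌋₊ - 2) 0 χ₀ ∧
          star χ₀ ⬝ᵥ χ₀ = 1 ∧
          a * (L : ℝ) ^ 4 ≤ ‖star χ₀ ⬝ᵥ Matrix.mulVec (pairField dWaveFormFactor L) φ₀‖ ^ 2) := by
  sorry

/-! ## The compositions -/

/-- **`JmPairBridge_of`** — the line closes the crux modulo its ONE remaining stub: the residue
`stub_someBridgeIrreducibleWitness` supplies `(U, δ, a, L₀)`, and at every even `L ≥ L₀` the torus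
every-from-some transfer (landed stubs 1–2) upgrades the bridged pair to every unit ground state. [folklore] -/
theorem JmPairBridge_of : JmPairBridge := by
  obtain ⟨U, hU, δ, hδ, a, ha, L₀, h⟩ := stub_someBridgeIrreducibleWitness
  refine ⟨U, hU, δ, hδ, a, ha, L₀, fun L _ hE hL φ hφ hφ1 => ?_⟩
  obtain ⟨⟨S, hS, hirr⟩, hsome⟩ := h L hE hL
  -- = `everyFromSome_torus L U _ _ S hS hirr hsome φ hφ hφ1` (landed composition of stubs 1 + 2,
  -- `Theorems/JosephsonMirrorJmPairBridgeSchurCusp.lean`), inlined so that the skeleton needs only the stub modules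
  exact stub_everyFromSome_torus
    (fun _ _ _ Δ F Fm S' hSU hSF hSF' hSFm hSFm' hSΔ hirr' t' hsome' =>
      stub_schurBridge Δ F Fm S' hSU hSF hSF' hSFm hSFm' hSΔ hirr' t' hsome')
    L U _ _ S hS hirr hsome φ hφ hφ1

end Summit.HubbardSuperconductivity.HubbardSuperconductivity.Theorems.JosephsonMirror

end
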